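import Mathlib.Algebra.Field.ZMod
import Mathlib.Analysis.Complex.ExponentialBounds
import Mathlib.Analysis.SpecialFunctions.BinaryEntropy
import Mathlib.Logic.Equiv.Fin.Basic
import Literature.Combinatorics.BinomialEntropyBound
import Literature.InformationTheory.Coding.DualDistance
import Literature.InformationTheory.Coding.GilbertVarshamovDual
import Literature.InformationTheory.Coding.SubfieldImage
import HarnessLib

/-!
# Binary linear codes whose nonzero codewords and nonzero dual words all have weight `> n/16`

`Literature/InformationTheory/Coding`: the binary, rate-`1/2` specialisation of the simultaneous
Gilbert–Varshamov argument of `GilbertVarshamovDual.lean` (`exists_matrix_sysCode_good`: if the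
Hamming ball `B_t ⊆ F^{κ ⊕ μ}` has `|B_t| (q^{|κ|} + q^{|μ|}) < q^{|κ|+|μ|}` then some systematic code
`{(x, xA)}` and its dual both have minimum distance `> t`), made numerical with van Lint's entropy
estimate `Σ_{i ≤ λn} (n choose i) ≤ e^{n H(λ)}` (*Introduction to Coding Theory*, GTM 86,
Thm. 1.4.5 (i); vendored as `Literature.Combinatorics.vanLint_sum_choose_le_exp_binEntropy`) at
`λ = 1/16`, where `H(1/16) ≤ (4 log 2 + 1)/16` and `k (4 log 2 + 1)/8 + log 2 < k log 2` for
`k ≥ 4` (`log 2 > 0.6931`, `Real.log_two_gt_d9`):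

* `exists_matrix_lt_minDist_lt_dualDist`: the general existence theorem restated with the
  tree's `minDist` / `dualDist` (`∃ A, t < minDist (sysCode A) ∧ t < dualDist (sysCode A)`);
* `exists_code_weights_gt`: for `k ≥ 4`, `16 t ≤ 2k` and any coordinate set `ι` with `|ι| = 2k`
  there is a binary linear code `C ≤ 𝔽₂^ι` such that every nonzero codeword and every nonzero
  word orthogonal to `C` has Hamming weight `> t`.

So at every even length `n ≥ 8` there are binary linear codes with minimum distance AND dual
distance `> ⌊n/16⌋` — the existence counterpart (random codes, no decoder) of the explicit
algebraic-geometry codes behind `Literature.Barriers.PneNP.DecodableDualDistanceCodes`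
(Holmgren–Wein 2021 Prop. 3: dual distance `≥ n/30`, unique decoding radius `n/60`).

## References

* J. H. van Lint, *Introduction to Coding Theory*, GTM 86, Thm. 1.4.5 (i) (the entropy bound).
* R. Lidl, G. Pilz, *Applied Abstract Algebra* (1998), Thm. 17.14, p. 177 (Gilbert–Varshamov).
-/

namespace Literature.InformationTheory.Coding

open Matrix Finset Real

/-! ### The existence theorem in terms of `minDist` / `dualDist` -/

section MinDist

variable {F : Type*} [Field F] [Fintype F] [DecidableEq F]
  {κ μ : Type*} [Fintype κ] [Fintype μ] [DecidableEq κ] [DecidableEq μ]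

/-- `exists_matrix_sysCode_good` in the language of `Literature/InformationTheory/Coding/
DualDistance.lean`: under the ball-count hypothesis some systematic code `C_A` has minimum
distance `> t` AND dual distance `> t` (`minDist`, `dualDist` as extended naturals). [folklore] -/
theorem exists_matrix_lt_minDist_lt_dualDist (t : ℕ)
    (hB : #{z : κ ⊕ μ → F | hammingNorm z ≤ t} *
        (Fintype.card F ^ Fintype.card κ + Fintype.card F ^ Fintype.card μ) <
      Fintype.card F ^ (Fintype.card κ + Fintype.card μ)) :
    ∃ A : Matrix κ μ F, (t : ℕ∞) < minDist (sysCode A) ∧ (t : ℕ∞) < dualDist (sysCode A) := by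
  obtain ⟨A, h1, h2⟩ := exists_matrix_sysCode_good t hB
  refine ⟨A, ?_, natCast_lt_dualDist_iff.2 h2⟩
  rw [← ENat.add_one_le_iff (ENat.coe_ne_top t)]
  exact le_minDist_iff.2 fun c hc h0 => by exact_mod_cast h1 c hc h0

end MinDist

/-! ### Binary codes: the ball count, the entropy step, and the existence theorem -/

section Binary

variable {ι : Type*} [Fintype ι]

/-- The binary Hamming ball of radius `t` in `𝔽₂^ι` has at most `Σ_{j ≤ t} (|ι| choose j)` points
(a binary word is its support). [folklore] -/
theorem card_filter_hammingNorm_le [DecidableEq ι] (t : ℕ) :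
    #{z : ι → ZMod 2 | hammingNorm z ≤ t} ≤ ∑ j ∈ range (t + 1), (Fintype.card ι).choose j := by
  set T : Finset (Finset ι) := (range (t + 1)).biUnion fun j => powersetCard j univ with hT
  have hTle : #T ≤ ∑ j ∈ range (t + 1), (Fintype.card ι).choose j :=
    card_biUnion_le.trans (le_of_eq (sum_congr rfl fun j _ => by rw [card_powersetCard, card_univ]))
  refine le_trans (card_le_card_of_injOn (fun z : ι → ZMod 2 => ({i | z i ≠ 0} : Finset ι))
    (fun z hz => ?_) (fun z _ z' _ h => ?_)) hTle
  · have hz' : hammingNorm z ≤ t := by simpa using hz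
    rw [mem_coe, hT, mem_biUnion]
    exact ⟨hammingNorm z, mem_range.2 (Nat.lt_succ_of_le hz'),
      mem_powersetCard.2 ⟨subset_univ _, rfl⟩⟩
  · funext i
    have hi : z i ≠ 0 ↔ z' i ≠ 0 := by
      have := Finset.ext_iff.1 h i
      simpa using this
    have key : ∀ a b : ZMod 2, (a ≠ 0 ↔ b ≠ 0) → a = b := by decide
    exact key _ _ hi

/-- The entropy constant: `H(1/16) ≤ (4 log 2 + 1)/16` (nats; `log (16/15) ≤ 1/15`). [folklore] -/
theorem binEntropy_one_div_sixteen_le : binEntropy (1 / 16 : ℝ) ≤ (4 * Real.log 2 + 1) / 16 := by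
  have h1 : binEntropy (1 / 16 : ℝ) = 1 / 16 * Real.log 16 + 15 / 16 * Real.log (16 / 15) := by
    simp only [binEntropy]
    norm_num
  have h16 : Real.log (16 : ℝ) = 4 * Real.log 2 := by
    rw [show (16 : ℝ) = 2 ^ 4 by norm_num, Real.log_pow]
    norm_num
  have h3 : Real.log (16 / 15 : ℝ) ≤ 16 / 15 - 1 := Real.log_le_sub_one_of_pos (by norm_num)
  rw [h1, h16]
  linarith

/-- **The numerical step.** For `k ≥ 4` and `16 t ≤ 2k`:
`2 · Σ_{j ≤ t} (2k choose j) < 2^k` (van Lint's bound at `λ = 1/16` and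
`H(1/16) < (log 2)/2 - (log 2)/k`). [folklore] -/
theorem sum_choose_mul_two_lt_two_pow (k t : ℕ) (hk : 4 ≤ k) (ht : 16 * t ≤ k + k) :
    (∑ j ∈ range (t + 1), ((k + k).choose j : ℝ)) * 2 < 2 ^ k := by
  set n := k + k with hn
  have hn' : (n : ℝ) = 2 * k := by rw [hn]; push_cast; ring
  have hk' : (4 : ℝ) ≤ k := by exact_mod_cast hk
  have hmono : ∑ j ∈ range (t + 1), (n.choose j : ℝ) ≤
      ∑ j ∈ range (⌊(1 / 16 : ℝ) * n⌋₊ + 1), (n.choose j : ℝ) := by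
    apply sum_le_sum_of_subset_of_nonneg
    · apply range_subset_range.2
      have h16 : (16 * t : ℝ) ≤ n := by rw [hn]; exact_mod_cast ht
      have : t ≤ ⌊(1 / 16 : ℝ) * n⌋₊ := Nat.le_floor (by linarith)
      omega
    · intro j _ _
      positivity
  have hvl := Literature.Combinatorics.vanLint_sum_choose_le_exp_binEntropy n (l := 1 / 16)
    (by norm_num) (by norm_num)
  have hH := binEntropy_one_div_sixteen_le
  have hlog := Real.log_two_gt_d9
  have hexp : Real.exp (n * binEntropy (1 / 16)) * 2 < 2 ^ k := by
    have hnH : (n : ℝ) * binEntropy (1 / 16) ≤ 2 * k * ((4 * Real.log 2 + 1) / 16) := by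
      rw [hn']
      exact mul_le_mul_of_nonneg_left hH (by positivity)
    have hlt : (n : ℝ) * binEntropy (1 / 16) + Real.log 2 < k * Real.log 2 := by
      nlinarith [mul_nonneg (sub_nonneg.2 hk') (sub_nonneg.2 hlog.le)]
    calc Real.exp (n * binEntropy (1 / 16)) * 2
        = Real.exp (n * binEntropy (1 / 16) + Real.log 2) := by
          rw [Real.exp_add, Real.exp_log two_pos]
      _ < Real.exp (k * Real.log 2) := Real.exp_lt_exp.2 hlt
      _ = 2 ^ k := by rw [Real.exp_nat_mul, Real.exp_log two_pos]
  calc (∑ j ∈ range (t + 1), (n.choose j : ℝ)) * 2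
      ≤ Real.exp (n * binEntropy (1 / 16)) * 2 := by
        have := hmono.trans hvl
        linarith
    _ < 2 ^ k := hexp

/-- **Binary linear codes with all nonzero codeword weights and all nonzero dual weights `> n/16`
exist at every even length `n = 2k ≥ 8`** (Gilbert–Varshamov for a code and its dual
simultaneously, binary, rate `1/2`): for `k ≥ 4`, `16 t ≤ 2k` and any coordinate set `ι` with
`|ι| = 2k` there is `C ≤ 𝔽₂^ι` such that every nonzero `c ∈ C` and every nonzero `y ⊥ C` have
Hamming weight `> t`. The code is a reindexed systematic code `{(x, xA)}`, `A ∈ 𝔽₂^{k × k}` from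
`exists_matrix_sysCode_good` (the ball of radius `t ≤ n/16` has `≤ e^{n H(1/16)} < 2^{k-1}` points).
Existence only: no decoder is provided. [folklore] -/
theorem exists_code_weights_gt [DecidableEq ι] (k t : ℕ) (hk : 4 ≤ k) (ht : 16 * t ≤ k + k)
    (hι : Fintype.card ι = k + k) :
    ∃ C : Submodule (ZMod 2) (ι → ZMod 2),
      (∀ c ∈ C, c ≠ 0 → t < hammingNorm c) ∧
      (∀ y : ι → ZMod 2, (∀ c ∈ C, c ⬝ᵥ y = 0) → y ≠ 0 → t < hammingNorm y) := by
  -- the counting hypothesis over `𝔽₂` with `κ = μ = Fin k`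
  have hBle : #{z : Fin k ⊕ Fin k → ZMod 2 | hammingNorm z ≤ t} ≤
      ∑ j ∈ range (t + 1), (k + k).choose j := by
    have h := card_filter_hammingNorm_le (ι := Fin k ⊕ Fin k) t
    rwa [Fintype.card_sum, Fintype.card_fin] at h
  have hnat : #{z : Fin k ⊕ Fin k → ZMod 2 | hammingNorm z ≤ t} * 2 < 2 ^ k := by
    have h1 : (#{z : Fin k ⊕ Fin k → ZMod 2 | hammingNorm z ≤ t} : ℝ) * 2 < 2 ^ k :=
      calc (#{z : Fin k ⊕ Fin k → ZMod 2 | hammingNorm z ≤ t} : ℝ) * 2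
          ≤ (∑ j ∈ range (t + 1), ((k + k).choose j : ℝ)) * 2 := by
            gcongr
            exact_mod_cast hBle
        _ < 2 ^ k := sum_choose_mul_two_lt_two_pow k t hk ht
    exact_mod_cast h1
  have hB : #{z : Fin k ⊕ Fin k → ZMod 2 | hammingNorm z ≤ t} *
      (Fintype.card (ZMod 2) ^ Fintype.card (Fin k) + Fintype.card (ZMod 2) ^ Fintype.card (Fin k)) <
      Fintype.card (ZMod 2) ^ (Fintype.card (Fin k) + Fintype.card (Fin k)) := by
    rw [ZMod.card, Fintype.card_fin]
    calc #{z : Fin k ⊕ Fin k → ZMod 2 | hammingNorm z ≤ t} * (2 ^ k + 2 ^ k)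
        = #{z : Fin k ⊕ Fin k → ZMod 2 | hammingNorm z ≤ t} * 2 * 2 ^ k := by ring
      _ < 2 ^ k * 2 ^ k := Nat.mul_lt_mul_of_pos_right hnat (pow_pos two_pos k)
      _ = 2 ^ (k + k) := (pow_add 2 k k).symm
  obtain ⟨A, hA₁, hA₂⟩ := exists_matrix_sysCode_good (F := ZMod 2) (κ := Fin k) (μ := Fin k) t hB
  let e : Fin k ⊕ Fin k ≃ ι := finSumFinEquiv.trans (Fintype.equivFinOfCardEq hι).symm
  refine ⟨reindex e (sysCode A), fun c hc h0 => ?_, fun y hy hy0 => ?_⟩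
  · have h1 : ((t + 1 : ℕ) : ℕ∞) ≤ minDist (reindex e (sysCode A)) := by
      rw [minDist_reindex]
      exact le_minDist_iff.2 fun c hc h0 => ENat.coe_le_coe.2 (hA₁ c hc h0)
    exact ENat.coe_le_coe.1 (le_minDist_iff.1 h1 c hc h0)
  · have h1 : ((t + 1 : ℕ) : ℕ∞) ≤ dualDist (reindex e (sysCode A)) := by
      rw [dualDist_reindex]
      exact le_dualDist_iff.2 fun y hy hy0 => ENat.coe_le_coe.2 (hA₂ y hy hy0)
    exact ENat.coe_le_coe.1 (le_dualDist_iff.1 h1 y hy hy0)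

end Binary

end Literature.InformationTheory.Coding
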